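import Mathlib
import Literature.Analysis.FluidPDE.Tao2016AveragedNS.ShiftSetCascadeFlows
import Summits.NavierStokesRegularity.NavierStokesRegularity.Theorems.TaoLadderRungTwoFlatMirrorTableDefs
import Summits.NavierStokesRegularity.NavierStokesRegularity.Theorems.TaoLadderRungTwoFlatMirrorField
import HarnessLib

/-!
# Reversibility of the mirror-seeded Toda table `mirrorTable ε ε` on `S♭` at scale ratio `1`
  (helper for item stmt-NavierStokesRegularity-22987 `FlatGapCertificatesV2`, crux K_A♭ of route
  TaoLadderRungTwoFlat; cell harvest/h2-tao-ladder, p1 g19 — the kernel form of theory-1 g34's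
  «time-reversal × lattice-reflection» mechanism for the zero first-order wake of the mirror table)

The HOMOGENEOUS (`ε₀ = 0`, all clocks `1`) two-species lattice of `mirrorTable ε δ` reads (carrier `a = S 0`,
bond `v = S 1`; tree lemmas `MirrorField.quadTermOn_mirrorTable_carrier/bond`)
`ȧ_n = v_{n-1}² + δ a_n v_{n-1} − v_n² − ε a_n v_n`, `v̇_n = a_n v_n + ε a_n² − a_{n+1} v_n − δ a_{n+1}²`.
Under the LATTICE REFLECTION `(Ra)_n := a_{−n}`, `(Rv)_n := v_{−n−1}` (sites to mirrored sites, the bond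
between `n, n+1` to the bond between `−n−1, −n`) the nonlinearity satisfies
`Q(RX) + R(Q X) = (δ − ε) · D(X)` (`quadTermOn_reflectFam_add`), with `D` an explicit quadratic; hence
EXACTLY WHEN `δ = ε` the field ANTI-COMMUTES with `R` (`quadTermOn_reflectFam`,
`quadTermOn_reflectFam_iff`), i.e. the homogeneous mirror lattice is REVERSIBLE: `t ↦ R X(τ − t)` maps
exact flows on `[0, τ]` to exact flows on `[0, τ]` (`pseudoFlowOnShift_reverse`). (At ratio `1+ε₀ ≠ 1`
the same computation conjugates the cascade to the time-reversed cascade of the INVERSE ratio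
`(1+ε₀)⁻¹`, up to the constant clock `(1+ε₀)^{-5/2}` — the grading is `R`-odd; not needed here.)
Use (theory-1 g34 / LADDER §46): the first-order Melnikov integral of the `R`-odd grading perturbation
against an `R`-symmetric solitary wave of the reversible `λ = 1` lattice vanishes — the desk mechanism
behind the measured per-hop wake `c(ε)·ε₀²` (NUM-T21) of the K_A♭ witness.

HONEST FRAMING: finite algebra and a change of variables for a MODEL lattice (Tao 2016 §4 vocabulary,
shift set `S♭`); nothing is certified here, no solitary wave is constructed, and nothing is a statement
about the Navier–Stokes equations.
-/

noncomputable section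

-- the sub-problem namespace repeats the summit name by design (D-0017)
set_option linter.dupNamespace false

namespace Summit.NavierStokesRegularity.NavierStokesRegularity.Theorems

open Set Literature.Analysis.FluidPDE Literature.Analysis.FluidPDE.TaoCascade

namespace MirrorReversibility

/-- The reflected shell index: sites `n ↦ −n` for the carrier (species `0`), bonds `n ↦ −n−1` for the
bond (species `1`; the bond between sites `n, n+1` goes to the bond between `−n−1, −n`).
[cite: Tao2016AveragedNS, §4 (4.1) (shell indexing); route TaoLadderRungTwoFlat, posited table] -/
def reflIdx (i : Fin 2) (k : ℤ) : ℤ := if i = 0 then -k else -k - 1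

/-- The reflected index is an involution. [cite: Tao2016AveragedNS, §4 (4.1)] -/
theorem reflIdx_reflIdx (i : Fin 2) (k : ℤ) : reflIdx i (reflIdx i k) = k := by
  fin_cases i <;> simp [reflIdx]

/-- The LATTICE REFLECTION of a two-species family: carrier `(RX)_{0,n} = X_{0,−n}`, bond
`(RX)_{1,n} = X_{1,−n−1}` (time untouched). [cite: Tao2016AveragedNS, §4 (4.1) (shell indexing); route TaoLadderRungTwoFlat, posited table] -/
def reflectFam (X : Fin 2 → ℤ → ℝ → ℝ) : Fin 2 → ℤ → ℝ → ℝ :=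
  fun i k t => X i (reflIdx i k) t

/-- Carrier component of the reflection. [cite: Tao2016AveragedNS, §4 (4.1)] -/
@[simp] theorem reflectFam_zero (X : Fin 2 → ℤ → ℝ → ℝ) (k : ℤ) (t : ℝ) :
    reflectFam X 0 k t = X 0 (-k) t := by
  simp [reflectFam, reflIdx]

/-- Bond component of the reflection. [cite: Tao2016AveragedNS, §4 (4.1)] -/
@[simp] theorem reflectFam_one (X : Fin 2 → ℤ → ℝ → ℝ) (k : ℤ) (t : ℝ) :
    reflectFam X 1 k t = X 1 (-k - 1) t := by
  simp [reflectFam, reflIdx]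

/-- The reflection is an involution. [cite: Tao2016AveragedNS, §4 (4.1)] -/
theorem reflectFam_reflectFam (X : Fin 2 → ℤ → ℝ → ℝ) : reflectFam (reflectFam X) = X := by
  funext i k t
  simp [reflectFam, reflIdx_reflIdx]

/-- The REVERSIBILITY DEFECT `D(X)`: carrier `a_{−n}(v_{−n} + v_{−n−1})`, bond `−(a_{−n}² + a_{−n−1}²)`
(written in the reflected variables: `(Ra)_n((Rv)_{n−1} + (Rv)_n)` and `−((Ra)_n² + (Ra)_{n+1}²)`).
[cite: Tao2016AveragedNS, §4 (4.8); route TaoLadderRungTwoFlat, posited table] -/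
def reversibilityDefect (X : Fin 2 → ℤ → ℝ → ℝ) : Fin 2 → ℤ → ℝ → ℝ :=
  fun i n t => if i = 0 then X 0 (-n) t * (X 1 (-n) t + X 1 (-n - 1) t)
    else -(X 0 (-n) t ^ 2 + X 0 (-n - 1) t ^ 2)

/-- Carrier equation of the homogeneous (`ε₀ = 0`) mirror lattice.
[cite: Tao2016AveragedNS, §4 (4.8); route TaoLadderRungTwoFlat, posited table] -/
theorem quadTermOn_zero_carrier (ε δ : ℝ) (X : Fin 2 → ℤ → ℝ → ℝ) (n : ℤ) (t : ℝ) :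
    quadTermOn shiftSetFlat 0 (mirrorTable ε δ) X 0 n t =
      (X 1 (n - 1) t ^ 2 + δ * (X 0 n t * X 1 (n - 1) t)) - (X 1 n t ^ 2 + ε * (X 0 n t * X 1 n t)) := by
  rw [MirrorField.quadTermOn_mirrorTable_carrier]
  simp

/-- Bond equation of the homogeneous (`ε₀ = 0`) mirror lattice.
[cite: Tao2016AveragedNS, §4 (4.8); route TaoLadderRungTwoFlat, posited table] -/
theorem quadTermOn_zero_bond (ε δ : ℝ) (X : Fin 2 → ℤ → ℝ → ℝ) (n : ℤ) (t : ℝ) :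
    quadTermOn shiftSetFlat 0 (mirrorTable ε δ) X 1 n t =
      X 0 n t * X 1 n t + ε * X 0 n t ^ 2 - X 0 (n + 1) t * X 1 n t - δ * X 0 (n + 1) t ^ 2 := by
  rw [MirrorField.quadTermOn_mirrorTable_bond]
  simp

/-- **THE REVERSIBILITY IDENTITY WITH DEFECT**: for every `ε, δ` and every family `X`,
`Q(RX) + R(Q X) = (δ − ε) · D(X)` on the homogeneous mirror lattice.
[cite: Tao2016AveragedNS, §4 (4.8); route TaoLadderRungTwoFlat, posited table] -/
theorem quadTermOn_reflectFam_add (ε δ : ℝ) (X : Fin 2 → ℤ → ℝ → ℝ) (i : Fin 2) (n : ℤ) (t : ℝ) :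
    quadTermOn shiftSetFlat 0 (mirrorTable ε δ) (reflectFam X) i n t +
        reflectFam (fun j k s => quadTermOn shiftSetFlat 0 (mirrorTable ε δ) X j k s) i n t =
      (δ - ε) * reversibilityDefect X i n t := by
  fin_cases i
  · simp only [Fin.zero_eta, Fin.isValue, reflectFam, reflIdx, quadTermOn_zero_carrier,
      reversibilityDefect, if_true, one_ne_zero, if_false]
    have e1 : -(n - 1) - 1 = -n := by ring
    rw [e1]
    ring
  · simp only [Fin.mk_one, Fin.isValue, reflectFam, reflIdx, quadTermOn_zero_bond,
      reversibilityDefect, one_ne_zero, if_false, if_true]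
    have e1 : -(n + 1) = -n - 1 := by ring
    have e2 : -n - 1 + 1 = -n := by ring
    rw [e1, e2]
    ring

/-- **REVERSIBILITY (`δ = ε`)**: the homogeneous mirror lattice ANTI-COMMUTES with the lattice reflection,
`Q(RX) = −R(Q X)`. [cite: Tao2016AveragedNS, §4 (4.8); route TaoLadderRungTwoFlat, posited table] -/
theorem quadTermOn_reflectFam (ε : ℝ) (X : Fin 2 → ℤ → ℝ → ℝ) (i : Fin 2) (n : ℤ) (t : ℝ) :
    quadTermOn shiftSetFlat 0 (mirrorTable ε ε) (reflectFam X) i n t =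
      -reflectFam (fun j k s => quadTermOn shiftSetFlat 0 (mirrorTable ε ε) X j k s) i n t := by
  have h := quadTermOn_reflectFam_add ε ε X i n t
  rw [sub_self, zero_mul] at h
  linarith

/-- **… AND ONLY THEN**: the anti-commutation `Q(RX) = −R(QX)` holds for all families iff `δ = ε` (the
detuned tables of NUM-T21 Table C are not reversible). [cite: Tao2016AveragedNS, §4 (4.8); route TaoLadderRungTwoFlat, posited table] -/
theorem quadTermOn_reflectFam_iff (ε δ : ℝ) :
    (∀ (X : Fin 2 → ℤ → ℝ → ℝ) (i : Fin 2) (n : ℤ) (t : ℝ),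
        quadTermOn shiftSetFlat 0 (mirrorTable ε δ) (reflectFam X) i n t =
          -reflectFam (fun j k s => quadTermOn shiftSetFlat 0 (mirrorTable ε δ) X j k s) i n t) ↔
      δ = ε := by
  constructor
  · intro h
    -- test family: carrier ≡ 1, bond ≡ 0; bond component at n = 0 gives `-2(δ - ε) = 0`
    have h1 := h (fun i _ _ => if i = 0 then 1 else 0) 1 0 0
    have h2 := quadTermOn_reflectFam_add ε δ (fun i _ _ => if i = 0 then 1 else 0) 1 0 0
    rw [h1, neg_add_cancel] at h2
    simp only [reversibilityDefect, Fin.isValue, one_ne_zero, if_false, if_true] at h2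
    norm_num at h2
    linarith
  · intro h
    rw [h]
    exact quadTermOn_reflectFam ε

/-! ### Reversed–reflected exact flows -/

/-- The nonlinearity only reads the family at the evaluation time: reparametrising time commutes with
`quadTermOn`. [cite: Tao2016AveragedNS, §4 (4.8)] -/
theorem quadTermOn_comp_time {m : ℕ} (𝕊 : Finset (ℤ × ℤ × ℤ)) (ε₀ : ℝ)
    (α : Fin m → Fin m → Fin m → ℤ × ℤ × ℤ → ℝ) (X : Fin m → ℤ → ℝ → ℝ) (φ : ℝ → ℝ)
    (i : Fin m) (n : ℤ) (t : ℝ) :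
    quadTermOn 𝕊 ε₀ α (fun j k s => X j k (φ s)) i n t = quadTermOn 𝕊 ε₀ α X i n (φ t) := rfl

/-- The TIME-REVERSED REFLECTED family on `[0, τ]`: `(𝓡S)_{i,k}(t) := (RS)_{i,k}(τ − t)`.
[cite: Tao2016AveragedNS, §4 (4.8); route TaoLadderRungTwoFlat, posited table] -/
def reverseFam (τ : ℝ) (S : Fin 2 → ℤ → ℝ → ℝ) : Fin 2 → ℤ → ℝ → ℝ :=
  fun i k t => reflectFam S i k (τ - t)

/-- Unfolding the reversed reflected family. [cite: Tao2016AveragedNS, §4 (4.8)] -/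
theorem reverseFam_eq (τ : ℝ) (S : Fin 2 → ℤ → ℝ → ℝ) (i : Fin 2) (k : ℤ) :
    reverseFam τ S i k = fun t => S i (reflIdx i k) (τ - t) := rfl

/-- Time reversal maps `[0, τ]` to itself. [folklore] -/
theorem sub_mem_Icc {τ t : ℝ} (ht : t ∈ Icc 0 τ) : τ - t ∈ Icc 0 τ :=
  ⟨by linarith [ht.2], by linarith [ht.1]⟩

/-- `derivWithin` of `t ↦ f(τ − t)` on `[0, τ]` (`τ > 0`). [folklore] -/
theorem derivWithin_comp_sub {f : ℝ → ℝ} {τ : ℝ} (hτ : 0 < τ) (hf : ContDiffOn ℝ 1 f (Icc 0 τ))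
    {t : ℝ} (ht : t ∈ Icc 0 τ) :
    derivWithin (fun s => f (τ - s)) (Icc 0 τ) t = -derivWithin f (Icc 0 τ) (τ - t) := by
  have hmaps : MapsTo (fun s : ℝ => τ - s) (Icc 0 τ) (Icc 0 τ) := fun s hs => sub_mem_Icc hs
  have hd : HasDerivWithinAt f (derivWithin f (Icc 0 τ) (τ - t)) (Icc 0 τ) (τ - t) :=
    (hf.differentiableOn_one (τ - t) (sub_mem_Icc ht)).hasDerivWithinAt
  have hg : HasDerivWithinAt (fun s : ℝ => τ - s) (-1) (Icc 0 τ) t := by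
    simpa using (hasDerivWithinAt_id t (Icc 0 τ)).const_sub τ
  have hcomp : HasDerivWithinAt (fun s => f (τ - s)) (derivWithin f (Icc 0 τ) (τ - t) * -1) (Icc 0 τ) t :=
    hd.comp t hg hmaps
  rw [hcomp.derivWithin (uniqueDiffOn_Icc hτ t ht)]
  ring

/-- An exact zero-slack flow carries no phantom energy: `F = ½S²` on `[0, τ]`.
[cite: Tao2016AveragedNS, §4 (4.10)] -/
theorem energy_eq_half_sq {m : ℕ} {𝕊 : Finset (ℤ × ℤ × ℤ)} {τ ε₀ : ℝ}
    {α : Fin m → Fin m → Fin m → ℤ × ℤ × ℤ → ℝ} {S₀ : Fin m → ℤ → ℝ} {S F : Fin m → ℤ → ℝ → ℝ}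
    (h : PseudoFlowOnShift 𝕊 τ ε₀ α 0 0 S₀ (fun i k => (1 / 2) * S₀ i k ^ 2) (fun _ _ => 0) S F)
    (i : Fin m) (k : ℤ) {s : ℝ} (hs : s ∈ Icc 0 τ) : F i k s = (1 / 2) * S i k s ^ 2 := by
  have h1 := h.defect_lower i k s hs
  have h2 := h.defect_upper i k s hs
  simp only [zero_mul, add_zero] at h2
  linarith

/-- **REVERSIBILITY OF THE HOMOGENEOUS MIRROR LATTICE AT THE LEVEL OF EXACT FLOWS.** If `(S, F)` is an
exact (defect-free, zero-slack) `S♭`-flow of `mirrorTable ε ε` at scale ratio `1` (`ε₀ = 0`) on `[0, τ]`,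
`τ > 0`, then the time-reversed reflected family `𝓡S`, with energies `½(𝓡S)²`, is an exact flow on
`[0, τ]` from the reflected END state `R S(τ)`.
[cite: Tao2016AveragedNS, §4 Lemma 4.1 (4.5), (4.8)–(4.10) (displays); route TaoLadderRungTwoFlat, posited table] -/
theorem pseudoFlowOnShift_reverse {τ ε : ℝ} (hτ : 0 < τ) {S₀ : Fin 2 → ℤ → ℝ} {S F : Fin 2 → ℤ → ℝ → ℝ}
    (h : PseudoFlowOnShift shiftSetFlat τ 0 (mirrorTable ε ε) 0 0 S₀ (fun i k => (1 / 2) * S₀ i k ^ 2)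
      (fun _ _ => 0) S F) :
    PseudoFlowOnShift shiftSetFlat τ 0 (mirrorTable ε ε) 0 0 (fun i k => reverseFam τ S i k 0)
      (fun i k => (1 / 2) * reverseFam τ S i k 0 ^ 2) (fun _ _ => 0) (reverseFam τ S)
      (fun i k t => (1 / 2) * reverseFam τ S i k t ^ 2) := by
  -- smoothness of the reversed reflected family
  have hmaps : MapsTo (fun s : ℝ => τ - s) (Icc 0 τ) (Icc 0 τ) := fun s hs => sub_mem_Icc hs
  have hsub : ContDiffOn ℝ 1 (fun s : ℝ => τ - s) (Icc 0 τ) := contDiffOn_const.sub contDiffOn_id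
  have hcd : ∀ i k, ContDiffOn ℝ 1 (reverseFam τ S i k) (Icc 0 τ) := by
    intro i k
    rw [reverseFam_eq]
    exact (h.contDiffOn_S i (reflIdx i k)).comp hsub hmaps
  -- the exact equation of motion of the original flow
  have hmot : ∀ i k s, s ∈ Icc 0 τ →
      derivWithin (S i k) (Icc 0 τ) s = quadTermOn shiftSetFlat 0 (mirrorTable ε ε) S i k s := by
    intro i k s hs
    have hm := h.motion i k s hs
    simp only [zero_mul] at hm
    have := abs_nonpos_iff.mp hm
    linarith
  -- its reversed reflected form
  have hrev : ∀ i k t, t ∈ Icc 0 τ →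
      derivWithin (reverseFam τ S i k) (Icc 0 τ) t =
        quadTermOn shiftSetFlat 0 (mirrorTable ε ε) (reverseFam τ S) i k t := by
    intro i k t ht
    have hq : quadTermOn shiftSetFlat 0 (mirrorTable ε ε) (reverseFam τ S) i k t =
        quadTermOn shiftSetFlat 0 (mirrorTable ε ε) (reflectFam S) i k (τ - t) :=
      quadTermOn_comp_time shiftSetFlat 0 (mirrorTable ε ε) (reflectFam S) (fun s => τ - s) i k t
    rw [hq, quadTermOn_reflectFam, reverseFam_eq,
      derivWithin_comp_sub hτ (h.contDiffOn_S i (reflIdx i k)) ht,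
      hmot i (reflIdx i k) (τ - t) (sub_mem_Icc ht)]
    rfl
  obtain ⟨M, hM⟩ := h.apriori_S
  refine
    { contDiffOn_S := hcd
      contDiffOn_F := fun i k => contDiffOn_const.mul ((hcd i k).pow 2)
      nonneg_F := fun i k s _ => by positivity
      apriori_S := ⟨M, fun s hs i k => ?_⟩
      apriori_F := ⟨M, fun s hs i k => ?_⟩
      init_S := fun i k => rfl
      init_F := fun i k => rfl
      motion := fun i k s hs => by rw [hrev i k s hs, sub_self, abs_zero, zero_mul, zero_mul]
      energy := fun i k s hs => ?_
      defect_lower := fun i k s hs => le_rfl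
      defect_upper := fun i k s hs => by simp }
  · -- (4.5), amplitudes: the same bound at the reflected site and reversed time (all weights are `2`)
    have h1 := hM (τ - s) (sub_mem_Icc hs) i (reflIdx i k)
    have h2 : (1 + (1 + (0 : ℝ)) ^ ((10 : ℝ) * k)) = 1 + (1 + (0 : ℝ)) ^ ((10 : ℝ) * (reflIdx i k : ℤ)) := by
      norm_num
    rw [h2]
    exact h1
  · -- (4.5), energies: `√(½x²) ≤ |x|`
    have hx : Real.sqrt ((1 / 2) * reverseFam τ S i k s ^ 2) ≤ |reverseFam τ S i k s| := by
      rw [show |reverseFam τ S i k s| = Real.sqrt (reverseFam τ S i k s ^ 2) from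
        (Real.sqrt_sq_eq_abs _).symm]
      exact Real.sqrt_le_sqrt (by nlinarith [sq_nonneg (reverseFam τ S i k s)])
    have hw : (0 : ℝ) ≤ 1 + (1 + 0) ^ ((10 : ℝ) * k) := by norm_num
    have hb : (1 + (1 + (0 : ℝ)) ^ ((10 : ℝ) * k)) * |reverseFam τ S i k s| ≤ M := by
      have h1 := hM (τ - s) (sub_mem_Icc hs) i (reflIdx i k)
      have h2 : (1 + (1 + (0 : ℝ)) ^ ((10 : ℝ) * k)) = 1 + (1 + (0 : ℝ)) ^ ((10 : ℝ) * (reflIdx i k : ℤ)) := by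
        norm_num
      rw [h2]
      exact h1
    exact (mul_le_mul_of_nonneg_left hx hw).trans hb
  · -- (4.9) with equality: d/dt ½(𝓡S)² = (𝓡S)·Q(𝓡S)
    have hd : HasDerivWithinAt (reverseFam τ S i k) (derivWithin (reverseFam τ S i k) (Icc 0 τ) s)
        (Icc 0 τ) s := ((hcd i k).differentiableOn_one s hs).hasDerivWithinAt
    have h2 : HasDerivWithinAt (fun t => (1 / 2) * reverseFam τ S i k t ^ 2)
        ((1 / 2) * (2 * reverseFam τ S i k s * derivWithin (reverseFam τ S i k) (Icc 0 τ) s))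
        (Icc 0 τ) s := by
      have := (hd.pow 2).const_mul (1 / 2)
      simpa using this
    rw [h2.derivWithin (uniqueDiffOn_Icc hτ s hs), hrev i k s hs]
    ring_nf
    rfl

/-! ### The graded lattice: the reflection conjugates ratio `1+ε₀` to the inverse ratio `(1+ε₀)⁻¹` -/

/-- The INVERSE RATIO: `1 + invRatio ε₀ = (1+ε₀)⁻¹`. [cite: Tao2016AveragedNS, §4 (4.8)] -/
def invRatio (ε₀ : ℝ) : ℝ := (1 + ε₀)⁻¹ - 1

/-- `1 + invRatio ε₀ = (1+ε₀)⁻¹`. [cite: Tao2016AveragedNS, §4 (4.8)] -/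
theorem one_add_invRatio (ε₀ : ℝ) : 1 + invRatio ε₀ = (1 + ε₀)⁻¹ := by
  simp [invRatio]

/-- Clocks of the inverse ratio are the reflected clocks: `(1+ε₀')^{5k/2} = (1+ε₀)^{5(−k)/2}`.
[cite: Tao2016AveragedNS, §4 (4.8)] -/
theorem invRatio_clock {ε₀ : ℝ} (hε : -1 < ε₀) (x : ℝ) :
    (1 + invRatio ε₀) ^ x = (1 + ε₀) ^ (-x) := by
  rw [one_add_invRatio, Real.inv_rpow (by linarith), Real.rpow_neg (by linarith)]

/-- The GRADED REVERSIBILITY DEFECT: carrier `a_{−n}(c_{n−1} v_{−n} + c_n v_{−n−1})`, bond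
`−c_n (a_{−n}² + a_{−n−1}²)`, `c_k = (1+ε₀)^{5k/2}` (at `ε₀ = 0` this is `reversibilityDefect`).
[cite: Tao2016AveragedNS, §4 (4.8); route TaoLadderRungTwoFlat, posited table] -/
def gradedDefect (ε₀ : ℝ) (X : Fin 2 → ℤ → ℝ → ℝ) : Fin 2 → ℤ → ℝ → ℝ :=
  fun i n t => if i = 0 then
      X 0 (-n) t * ((1 + ε₀) ^ ((5 : ℝ) * (n - 1) / 2) * X 1 (-n) t + (1 + ε₀) ^ ((5 : ℝ) * n / 2) * X 1 (-n - 1) t)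
    else -((1 + ε₀) ^ ((5 : ℝ) * n / 2) * (X 0 (-n) t ^ 2 + X 0 (-n - 1) t ^ 2))

/-- **THE GRADING IS `R`-ODD.** At scale ratio `1+ε₀` the reflected nonlinearity is, up to the constant
clock `(1+ε₀)^{-5/2}`, minus the reflection of the nonlinearity AT THE INVERSE RATIO `(1+ε₀)⁻¹`, plus the
detuning defect: `Q_{ε₀}(RX) + (1+ε₀)^{-5/2} · R(Q_{ε₀'} X) = (δ − ε) · D_{ε₀}(X)`, `1+ε₀' = (1+ε₀)⁻¹`. So for
`δ = ε` the reflection `R` together with time reversal (and the constant time change `t ↦ (1+ε₀)^{5/2} t`)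
conjugates the UP-cascade at ratio `1+ε₀` to the up-cascade at ratio `(1+ε₀)⁻¹`: the grading perturbation
`∂_{ε₀}` of the homogeneous lattice is ODD under the reversing symmetry — the input of the first-order
(Melnikov) wake cancellation for an `R`-symmetric solitary wave.
[cite: Tao2016AveragedNS, §4 (4.8); route TaoLadderRungTwoFlat, posited table] -/
theorem quadTermOn_reflectFam_add_graded {ε₀ : ℝ} (hε : -1 < ε₀) (ε δ : ℝ) (X : Fin 2 → ℤ → ℝ → ℝ)
    (i : Fin 2) (n : ℤ) (t : ℝ) :
    quadTermOn shiftSetFlat ε₀ (mirrorTable ε δ) (reflectFam X) i n t +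
        (1 + ε₀) ^ (-(5 : ℝ) / 2) *
          reflectFam (fun j k s => quadTermOn shiftSetFlat (invRatio ε₀) (mirrorTable ε δ) X j k s) i n t =
      (δ - ε) * gradedDefect ε₀ X i n t := by
  have hL : (0 : ℝ) < 1 + ε₀ := by linarith
  -- clock bookkeeping: every clock as a product with the reference clocks `c_n`, `c_{n-1}`
  have hc : ∀ x y : ℝ, (1 + ε₀) ^ x * (1 + ε₀) ^ y = (1 + ε₀) ^ (x + y) := fun x y =>
    (Real.rpow_add hL x y).symm
  fin_cases i
  · simp only [Fin.zero_eta, Fin.isValue, reflectFam, reflIdx, MirrorField.quadTermOn_mirrorTable_carrier,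
      gradedDefect, if_true, one_ne_zero, if_false, invRatio_clock hε]
    have e1 : -(n - 1) - 1 = -n := by ring
    rw [e1]
    -- the two reflected clocks: c'_{-n-1} = c_{n+1}, c'_{-n} = c_n, times (1+ε₀)^{-5/2}
    have k1 : (1 + ε₀) ^ (-(5 : ℝ) / 2) * (1 + ε₀) ^ (-((5 : ℝ) * (((-n : ℤ) : ℝ) - 1) / 2)) =
        (1 + ε₀) ^ ((5 : ℝ) * n / 2) := by
      rw [hc]; congr 1; push_cast; ring
    have k2 : (1 + ε₀) ^ (-(5 : ℝ) / 2) * (1 + ε₀) ^ (-((5 : ℝ) * ((-n : ℤ) : ℝ) / 2)) =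
        (1 + ε₀) ^ ((5 : ℝ) * (n - 1) / 2) := by
      rw [hc]; congr 1; push_cast; ring
    linear_combination (X 1 (-n - 1) t ^ 2 + δ * (X 0 (-n) t * X 1 (-n - 1) t)) * k1 -
      (X 1 (-n) t ^ 2 + ε * (X 0 (-n) t * X 1 (-n) t)) * k2
  · simp only [Fin.mk_one, Fin.isValue, reflectFam, reflIdx, MirrorField.quadTermOn_mirrorTable_bond,
      gradedDefect, one_ne_zero, if_false, if_true, invRatio_clock hε]
    have e1 : -(n + 1) = -n - 1 := by ring
    have e2 : -n - 1 + 1 = -n := by ring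
    rw [e1, e2]
    have k1 : (1 + ε₀) ^ (-(5 : ℝ) / 2) * (1 + ε₀) ^ (-((5 : ℝ) * (((-n - 1 : ℤ)) : ℝ) / 2)) =
        (1 + ε₀) ^ ((5 : ℝ) * n / 2) := by
      rw [hc]; congr 1; push_cast; ring
    linear_combination (X 0 (-n - 1) t * X 1 (-n - 1) t + ε * X 0 (-n - 1) t ^ 2 -
      X 0 (-n) t * X 1 (-n - 1) t - δ * X 0 (-n) t ^ 2) * k1

/-- **`δ = ε`: the graded mirror cascade is conjugate to the time-reversed cascade of the inverse ratio**,
`Q_{ε₀}(RX) = −(1+ε₀)^{-5/2} · R(Q_{ε₀'} X)` with `1+ε₀' = (1+ε₀)⁻¹`.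
[cite: Tao2016AveragedNS, §4 (4.8); route TaoLadderRungTwoFlat, posited table] -/
theorem quadTermOn_reflectFam_graded {ε₀ : ℝ} (hε : -1 < ε₀) (ε : ℝ) (X : Fin 2 → ℤ → ℝ → ℝ)
    (i : Fin 2) (n : ℤ) (t : ℝ) :
    quadTermOn shiftSetFlat ε₀ (mirrorTable ε ε) (reflectFam X) i n t =
      -((1 + ε₀) ^ (-(5 : ℝ) / 2) *
        reflectFam (fun j k s => quadTermOn shiftSetFlat (invRatio ε₀) (mirrorTable ε ε) X j k s) i n t) := by
  have h := quadTermOn_reflectFam_add_graded hε ε ε X i n t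
  rw [sub_self, zero_mul] at h
  linarith

end MirrorReversibility

end Summit.NavierStokesRegularity.NavierStokesRegularity.Theorems

end
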